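import Mathlib
import Literature.MathematicalPhysics.QuantumFieldTheory.Balaban1983to89.B12Decay510Window
import Literature.MathematicalPhysics.QuantumFieldTheory.Balaban1983to89.B14Eq348SecondClass

/-!
# `Balaban1983to89.B14.Eq348ClassGeometry` — T. Bałaban, *Convergent renormalization expansions for lattice gauge
# theories*, Commun. Math. Phys. **119** (1988) 243–285 [Balaban1988Convergent]: the GEOMETRY of the two classes
# (I.3.5) of localization domains behind (3.48) p. 280 — «X ∩ (□^{∼2})ᶜ ≠ ∅ ⇒ d_j(X) ≥ 2(LʲL⁻ⁿ)⁻¹» — PROVED for the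
# formalised tree length `TreeLength.treeLen`, and the hypothesis `hclass` of `B14.Eq348SecondClass` DISCHARGED on the
# concrete window system `TreeLengthCubeSystem.cubeSys B`

statement-level skeleton of published theorems with citation tags; proofs where landed; nothing here is a claim about the Yang–Mills mass gap

PDF held: `paper:balaban1988-cmp119-convergent-renormalization` (journal page = PDF page + 242); pp. 279–280 [PDF 37–38] re-read
as images on the x2 renders `…-p037-x2.png`, `…-p038-x2.png` of the cell `pub-balaban`; [Balaban1987RG1] p. 257 [PDF 9] and
p. 271 [PDF 23] re-read on the renders `1987-cmp109-rg-I-small-field-p009-x2.png`, `…-p023-x2.png`.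

CITATION HEADER (lean-in-tree rule).  WHAT IS REPRODUCED, verbatim.  [Balaban1988Convergent] p. 279: *"Let us assume
that z ∈ Λ_j⁰∩(Ω_n∖Ω_{n+1}), and let us take the cube □ ∈ π_n such that z ∈ □. We represent the function 𝐄^{(j)}(Λ_j, z)
as the sum (2.27) over the localization domains X ∈ 𝐃_j, X ⊂ Λ_j, z ∈ X. Consider the two cases (I.3.5): X ⊂ □^{∼2},
X∩(□^{∼2})ᶜ ≠ ∅ (the ∼-operation is in the L⁻ⁿ-scale). In the second case the function 𝐄^{(j)}(X, z) is already very
small by the bound (I.1.18):"* p. 280: *"|𝐄^{(j)}(X, z)| ≦ E₀ exp(−κ(LʲL⁻ⁿ)⁻¹) exp(−½κd_j(X)). (3.48) In the proof of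
Theorem 2 we simply estimate all these terms using the above bound, and the sum over X is bounded by
O(1)exp(−κ(LʲL⁻ⁿ)⁻¹) ≦ O(1)(LʲL⁻ⁿ)⁵."*  [Balaban1987RG1] (= [I]) p. 257: *"We decompose the space T into the lattice of
closed cubes of a size M, where M = Lᵐ, with centers at points of the lattice T_M^{(j+m)}. … We denote this family of
cubes by π_j, and the cubes by □, □′, etc. For a cube □ ∈ π_j and n = 1, 2, … we define □̃ⁿ as a cube of the size
(1 + 2n)M and with a center at the center of □. … The meaning of the symbol X̃ⁿ should be obvious. … A length of a
shortest graph in this class, divided by M, is the linear size of X, and is denoted by d_j(X). Thus we rescale the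
space, so that cubes from π_j become unit cubes, and we take the distance in this scale."*; (3.5) p. 271: *"The division
is according to the conditions X∩(□̃²)ᶜ ≠ ∅, or X ⊂ □̃². (3.5) Consider a domain X satisfying the first condition above.
Assume that X ∈ 𝐃_j. There are two cases possible, either X∩□̃ = ∅, or X∩□̃ ≠ ∅. In the first case dist(X, □) ≥ M … In
the second case X is a big domain in ξ-scale, for example d_j(X) ≥ (Lʲη)⁻¹."*; (1.18) p. 261: *"|𝐄^{(j)}(X, U′U_k(X))| ≦
E₀ exp(−κd_j(X))"*.  [Balaban1988RG2Cluster] (= [II]) (1.26) p. 8: *"Σ_{X∈𝐃_j, X⊃□′} exp(−κd_j(X)) ≤ O(1), (1.26) for κ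
sufficiently large."*

SKELETON row (owner r11): **B14.Eq3.48** (head `proved p251207`: `B14.Eq348SecondClass` — (3.48) termwise from (I.1.18)
and *"the sum over X is bounded by O(1)exp(−κ(LʲL⁻ⁿ)⁻¹) ≦ O(1)(LʲL⁻ⁿ)⁵"* with the O(1) explicit, on the abstract carrier
`B12TreeDecay.CubeSystem`, MODULO its model note (M1): the implication «X ∋ z, X ⊄ □^{∼2} ⇒ d_j(X) ≥ 2(LʲL⁻ⁿ)⁻¹» entered
as the hypothesis `hclass`, the degree bound `DegreeLE Δ` and the volume leaf `VolumeLeaf c₀` as hypotheses).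
WHAT IS PROVED HERE (theorems only; no `sorry`; nothing existing is modified).  On the continuum of `…TreeLength` (unit
cubes = the cubes of π_j, sup metric, d_j := `treeLen`) and the index model of `…B13ScaleTransfer` (`Pt d = ℤ^d`,
`coarse N` = the block index when π_n-cubes are the unions of N^d cubes of π_j, N = Lⁿ⁻ʲ):
* §1 `abs_sub_le_len_add_one`, `abs_sub_le_steinerLen_add_one`, **`abs_sub_le_treeLen_add_one`**,
  `dist_corner_le_treeLen_add_one` — the SHARP coordinate diameter bound |x_μ − y_μ| ≤ d_j(X) + 1 for two cubes x, y of a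
  localization domain (a graph meeting both cubes joins a point p with p_μ ≤ x_μ + 1 to a point q with q_μ ≥ y_μ; its
  μ-projection is an interval covered by the projected segments — `B12Decay510Window.dist_le_len`); sharpens the window
  module's `dist_corner_le_treeLen` (+2) to +1, optimal (two cubes with a common wall: d_j = 0, the cell's
  `B13Ineq232Star.treeLen_pair_of_adj`, indices differing by 1);
* §2 `blockGap_le_abs_sub` — a gap ≥ r + 1 of the π_n-block indices in one coordinate forces |x_μ − y_μ| ≥ rN + 1, hence
  **`mul_le_treeLen_of_blockGap`**: d_j(X) ≥ rN;
* §3 **`two_mul_le_treeLen_of_not_inEnl`** — THE SECOND CLASS of (3.48): if the cube x of z is a cube of X (□ := the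
  π_n-block of x, so z ∈ □) and X has a cube y outside □^{∼2} (block index farther than 2 from that of x in some
  coordinate: `¬ InEnl N 2 x y`), then d_j(X) ≥ 2N = 2(LʲL⁻ⁿ)⁻¹; and [I] (3.5) p. 271 *"for example d_j(X) ≥ (Lʲη)⁻¹"*
  SHARP: `le_treeLen_of_meets` (X meets □̃ and (□̃²)ᶜ ⇒ d_j(X) ≥ N, □ a cube of side 2N as in [I] p. 270, or any side);
* §4 on the concrete system of localization domains of a finite window `B ⊂ ℤ^d` (`TreeLengthCubeSystem.cubeSys B`, with
  `degreeLE B : DegreeLE (2d)` and `volumeLeaf B : VolumeLeaf (4·2^d)` already theorems there): `SecondClass B N c` = the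
  second class above the cube c, **`hclass_cubeSys`** = the hypothesis `hclass` of `B14.Eq348SecondClass.secondClass_sum_le`
  PROVED, whence **`secondClass_sum_le`**, **`secondClass_sum_le_pow_five`**, **`abs_secondClass_sum_le`**: the p. 280
  sentence with (I.1.18) as the ONLY hypothesis — Σ_{X ∋ c, X ⊄ □^{∼2}} |𝐄^{(j)}(X, z)| ≤ E₀K₀(4·2^d, 2d)e^{−κN} ≤
  E₀K₀(4·2^d, 2d)(5/κ)⁵e⁻⁵N⁻⁵ for κ/2 ≥ κ₀(4·2^d, 2d) (constants of `B12TreeDecay`, depending on d only), and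
  `secondClass_sum_le_scales`: N = Lⁿ⁻ʲ, N⁻¹ = LʲL⁻ⁿ written as the real power `L^{(j−n)}` of `B14Sect3.Rep367`.
Model notes (declared).  (M1′) π_n-blocks are modelled corner-anchored, `coarse N x = ⌊x/N⌋` (the cell's convention for
π_{k+1} ⊃ π_k, `B13ScaleTransfer.coarse`, [II] p. 13); the printed cubes are centred at the points of T_M^{(n+m)} — the same
nested partition up to a translation of the index lattice (nestedness of π_n over π_j needs Lⁿ⁻ʲ odd in the centred
picture; in the index model it holds by construction).  (M2′) "z ∈ X" for a lattice point z and a union X of closed cubes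
is carried, as in `B14.Eq348SecondClass`, by a chosen cube c ∋ z of π_j being a cube of X (`CubeSystem.above c`); □ is
the π_n-block of c.  (M3′) = (M2) there: (I.1.18) enters as the hypothesis `h118` on reals.  (M4′) the window has free
boundary (`TreeLengthCubeSystem`, WHAT IS NOT CLAIMED (i)): no wrap-around adjacency.

Mega-formalization `lit-balaban`, unit `lit-balaban-r11` gen 6 (B14 fold owner), HOME `run/shared/lean/pub/lit-balaban/`.

## References
* [Balaban1988Convergent] T. Bałaban, Commun. Math. Phys. 119 (1988) 243–285, pp. 279–280, (3.48).
* [Balaban1987RG1] T. Bałaban, Commun. Math. Phys. 109 (1987) 249–301 ([I]: p. 257, (1.18) p. 261, (3.5) p. 271).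
* [Balaban1988RG2Cluster] T. Bałaban, Commun. Math. Phys. 116 (1988) 1–22 ([II]: (1.26) p. 8).
* [Dimock2013BalabanII] J. Dimock, J. Math. Phys. 54 (2013) 092301, App. E (sup-metric convention of `TreeLength`).
-/

namespace Literature.MathematicalPhysics.QuantumFieldTheory.Balaban1983to89.B14.Eq348ClassGeometry

noncomputable section

open Literature.MathematicalPhysics.QuantumFieldTheory.Balaban1983to89
open Literature.MathematicalPhysics.QuantumFieldTheory.Balaban1983to89.B13ScaleTransfer
open Literature.MathematicalPhysics.QuantumFieldTheory.Balaban1983to89.TreeLength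
open Literature.MathematicalPhysics.QuantumFieldTheory.Balaban1983to89.TreeLengthCubeSystem
open Literature.MathematicalPhysics.QuantumFieldTheory.Balaban1983to89.B12TreeDecay
open Literature.MathematicalPhysics.QuantumFieldTheory.Balaban1983to89.B12Decay510Window (dist_le_len)
open Finset

variable {d : ℕ}

/-! ## §1. The sharp coordinate diameter bound |x_μ − y_μ| ≤ d_j(X) + 1 -/

/-- **Coordinate bound along a graph**: if a connected polygonal graph `T` meets the unit cubes of `x` and of `y`
([Balaban1987RG1] p. 257: graphs *"intersecting all the cubes in X"*, lengths in the rescaled picture), then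
`y_μ − x_μ ≤ |T| + 1` — the meeting points `p ∈ □_x`, `q ∈ □_y` have `p_μ ≤ x_μ + 1`, `q_μ ≥ y_μ` and `|p_μ − q_μ| ≤
dist_∞(p, q) ≤ |T|` (`B12Decay510Window.dist_le_len`). (Locus of the DEFINITION of d_j: Balaban1987RG1 p.257; the bound
itself is derived here, not printed.) [cite: Balaban1987RG1, p.257 (linear size d_j)] -/
theorem sub_le_len_add_one {Y : Finset (Pt d)} {T : List (Seg d)} (hT : SAdmissible Y T) {x y : Pt d}
    (hx : x ∈ Y) (hy : y ∈ Y) (i : Fin d) : ((y i : ℝ)) - x i ≤ len T + 1 := by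
  obtain ⟨p, hpT, hpx⟩ := hT.meets x hx
  obtain ⟨q, hqT, hqy⟩ := hT.meets y hy
  have h1 := (mem_cube.1 hpx) i
  have h2 := (mem_cube.1 hqy) i
  have h3 : dist p q ≤ len T := dist_le_len hT.connected.isPreconnected hpT hqT
  have h4 : |p i - q i| ≤ len T := by
    have h := dist_le_pi_dist p q i
    rw [Real.dist_eq] at h
    exact h.trans h3
  have h5 := (abs_le.1 h4).1
  linarith [h1.2, h2.1]

/-- The symmetric form: `|x_μ − y_μ| ≤ |T| + 1` for a connected graph meeting the cubes of `x` and `y`.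
[cite: Balaban1987RG1, p.257 (linear size d_j)] -/
theorem abs_sub_le_len_add_one {Y : Finset (Pt d)} {T : List (Seg d)} (hT : SAdmissible Y T) {x y : Pt d}
    (hx : x ∈ Y) (hy : y ∈ Y) (i : Fin d) : |((x i : ℝ)) - y i| ≤ len T + 1 := by
  rw [abs_le]
  constructor
  · have h := sub_le_len_add_one hT hx hy i
    linarith
  · have h := sub_le_len_add_one hT hy hx i
    linarith

/-- **`|x_μ − y_μ| ≤ ℓ̃(Y) + 1`** for two cubes of a non-empty family `Y` and the Steiner length of `TreeLength`
(infimum over the connected graphs meeting every cube of `Y`). [cite: Dimock2013BalabanII, App. E (preamble of Lemma E.1)] -/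
theorem abs_sub_le_steinerLen_add_one {Y : Finset (Pt d)} (hY : Y.Nonempty) {x y : Pt d} (hx : x ∈ Y) (hy : y ∈ Y)
    (i : Fin d) : |((x i : ℝ)) - y i| ≤ steinerLen Y + 1 := by
  obtain ⟨T₀, hT₀⟩ := exists_sAdmissible hY
  have h := le_steinerLen (a := |((x i : ℝ)) - y i| - 1) ⟨T₀, hT₀⟩ fun T hT => by
    have h' := abs_sub_le_len_add_one hT hx hy i
    linarith
  linarith

/-- **THE SHARP COORDINATE DIAMETER BOUND `|x_μ − y_μ| ≤ d_j(X) + 1`** for two cubes `x`, `y` of a localization domain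
`X` ([Balaban1987RG1] p. 257: `d_j` = *"A length of a shortest graph in this class, divided by M"*, cubes of π_j unit):
every admissible graph meets both cubes.  Sharpens `B12Decay510Window.dist_corner_le_treeLen` (`+ 2`) to `+ 1`, which is
optimal: two cubes with a common wall have `d_j = 0` (the cell's `B13Ineq232Star.treeLen_pair_of_adj`) and indices
differing by `1`. (Locus of the DEFINITION of d_j: p.257; the bound is derived here, not printed.)
[cite: Balaban1987RG1, p.257 (linear size d_j)] -/
theorem abs_sub_le_treeLen_add_one {X : Finset (Pt d)} (hX : X.Nonempty) (hc : FaceConnected X) {x y : Pt d}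
    (hx : x ∈ X) (hy : y ∈ X) (i : Fin d) : |((x i : ℝ)) - y i| ≤ treeLen X + 1 :=
  (abs_sub_le_steinerLen_add_one hX hx hy i).trans (by linarith [steinerLen_le_treeLen hX hc])

/-- The sup-metric form: `dist_∞(x, y) ≤ d_j(X) + 1` for the lower corners of two cubes of a localization domain.
[cite: Balaban1987RG1, p.257 (linear size d_j)] -/
theorem dist_corner_le_treeLen_add_one {X : Finset (Pt d)} (hX : X.Nonempty) (hc : FaceConnected X) {x y : Pt d}
    (hx : x ∈ X) (hy : y ∈ X) : dist (corner x) (corner y) ≤ treeLen X + 1 := by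
  rw [dist_pi_le_iff (by linarith [treeLen_nonneg X])]
  intro i
  rw [Real.dist_eq]
  exact abs_sub_le_treeLen_add_one hX hc hx hy i

/-! ## §2. Block indices: the π_n-cubes as unions of N^d cubes of π_j -/

/-- **`y ∈ □^{∼r}(x)`** — the cube `y` of π_j lies in the r-fold enlargement of the π_n-cube `□ ∋ x` ([Balaban1987RG1]
p. 257: *"□̃ⁿ as a cube of the size (1 + 2n)M and with a center at the center of □"*, here for `□ ∈ π_n` read in π_j-units,
[Balaban1988Convergent] p. 279 *"the ∼-operation is in the L⁻ⁿ-scale"*): the π_n-block indices `⌊y/N⌋`, `⌊x/N⌋`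
(`B13ScaleTransfer.coarse N`, N = Lⁿ⁻ʲ, model note M1′) differ by at most `r` in every coordinate.
[cite: Balaban1988Convergent, p.279 (the two cases (I.3.5))] -/
def InEnl (N r : ℕ) (x y : Pt d) : Prop := ∀ i, |coarse N y i - coarse N x i| ≤ r

/-- Membership in `□^{∼r}(x)` is decidable (finitely many integer comparisons). [folklore] -/
instance instDecidableInEnl (N r : ℕ) (x y : Pt d) : Decidable (InEnl N r x y) := by
  unfold InEnl
  infer_instance

/-- `x ∈ □^{∼r}(x)` (`□ ⊂ □̃ⁿ`, [Balaban1987RG1] p. 257). [cite: Balaban1988Convergent, p.279 (the two cases (I.3.5))] -/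
theorem inEnl_refl (N r : ℕ) (x : Pt d) : InEnl N r x x := fun i => by simp

/-- `y ∉ □^{∼r}(x)` — *"X∩(□^{∼2})ᶜ ≠ ∅"* cube by cube — iff some block-index coordinate of `y` is at least `r + 1` away
from that of `x`. [cite: Balaban1988Convergent, p.279 (the two cases (I.3.5))] -/
theorem not_inEnl_iff {N r : ℕ} {x y : Pt d} :
    ¬ InEnl N r x y ↔ ∃ i, (r : ℤ) + 1 ≤ |coarse N y i - coarse N x i| := by
  simp only [InEnl, not_forall, not_le]
  exact exists_congr fun i => Int.lt_iff_add_one_le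

/-- **Block gap ⇒ coordinate gap**: if the π_n-block indices of the cubes `x`, `y` differ by at least `r + 1` in the
coordinate `μ`, then `|y_μ − x_μ| ≥ rN + 1` (the blocks are the intervals `[Nb, N(b+1))`, `coarse_eq_iff`) — the lattice
arithmetic of [I]'s case distinction *"X∩□̃ ≠ ∅ … X∩(□̃²)ᶜ ≠ ∅"*. [cite: Balaban1987RG1, (3.5) p.271] -/
theorem blockGap_le_abs_sub {N : ℕ} (hN : 0 < N) {r : ℕ} {x y : Pt d} {i : Fin d}
    (h : (r : ℤ) + 1 ≤ |coarse N y i - coarse N x i|) : (r : ℤ) * N + 1 ≤ |y i - x i| := by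
  have hx := ((coarse_eq_iff hN x (coarse N x)).1 rfl i)
  have hy := ((coarse_eq_iff hN y (coarse N y)).1 rfl i)
  set cx := coarse N x i with hcx
  set cy := coarse N y i with hcy
  have hN0 : (0 : ℤ) ≤ (N : ℤ) := by exact_mod_cast hN.le
  rcases le_abs.1 h with h1 | h1
  · -- cy ≥ cx + r + 1
    have h2 : (N : ℤ) * (cx + r + 1) ≤ (N : ℤ) * cy := mul_le_mul_of_nonneg_left (by linarith) hN0
    have h3 : (r : ℤ) * N + 1 ≤ y i - x i := by nlinarith [hx.2, hy.1]
    exact h3.trans (le_abs_self _)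
  · -- cx ≥ cy + r + 1
    have h2 : (N : ℤ) * (cy + r + 1) ≤ (N : ℤ) * cx := mul_le_mul_of_nonneg_left (by linarith) hN0
    have h3 : (r : ℤ) * N + 1 ≤ x i - y i := by nlinarith [hy.2, hx.1]
    rw [abs_sub_comm]
    exact h3.trans (le_abs_self _)

/-- **`d_j(X) ≥ rN` from a block gap**: two cubes of a localization domain whose π_n-block indices differ by at least
`r + 1` in one coordinate force `d_j(X) ≥ rN` (§1 and `blockGap_le_abs_sub`). [cite: Balaban1987RG1, (3.5) p.271] -/
theorem mul_le_treeLen_of_blockGap {X : Finset (Pt d)} (hc : FaceConnected X) {N : ℕ} (hN : 0 < N) {r : ℕ}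
    {x y : Pt d} (hx : x ∈ X) (hy : y ∈ X) {i : Fin d} (h : (r : ℤ) + 1 ≤ |coarse N y i - coarse N x i|) :
    (r : ℝ) * N ≤ treeLen X := by
  have h1 := blockGap_le_abs_sub hN h
  have h2 := abs_sub_le_treeLen_add_one ⟨x, hx⟩ hc hy hx i
  have h1' : (r : ℝ) * N + 1 ≤ |((y i : ℝ)) - x i| := by
    have h3 := (Int.cast_le (R := ℝ)).2 h1
    push_cast at h3
    exact h3
  linarith

/-! ## §3. The second class of (3.48), and [I] (3.5) sharp -/

/-- **THE SECOND CLASS OF (3.48)** ([Balaban1988Convergent] pp. 279–280): if the cube `x ∋ z` of π_j is a cube of the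
localization domain `X` — so that `□ :=` the π_n-block of `x` is *"the cube □ ∈ π_n such that z ∈ □"* — and `X` has a cube
`y` outside `□^{∼2}` (*"X∩(□^{∼2})ᶜ ≠ ∅ (the ∼-operation is in the L⁻ⁿ-scale)"*), then **`d_j(X) ≥ 2N = 2(LʲL⁻ⁿ)⁻¹`**
— the exponent bookkeeping that turns (I.1.18) into (3.48) `E₀exp(−κ(LʲL⁻ⁿ)⁻¹)exp(−½κd_j(X))` (`B14.Eq348SecondClass.
ineq348_of_118`, `B14Sect3.exp_split_348`). [cite: Balaban1988Convergent, (3.48) p.280] -/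
theorem two_mul_le_treeLen_of_not_inEnl {X : Finset (Pt d)} (hc : FaceConnected X) {N : ℕ} (hN : 0 < N)
    {x y : Pt d} (hx : x ∈ X) (hy : y ∈ X) (h : ¬ InEnl N 2 x y) : 2 * (N : ℝ) ≤ treeLen X := by
  obtain ⟨i, hi⟩ := not_inEnl_iff.1 h
  have h' := mul_le_treeLen_of_blockGap hc hN hx hy (r := 2) (by exact_mod_cast hi)
  exact_mod_cast h'

/-- The general enlargement: a cube of `X` outside `□^{∼r}(x)`, `x` a cube of `X`, forces `d_j(X) ≥ rN`.
[cite: Balaban1988Convergent, p.279 (the two cases (I.3.5))] -/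
theorem mul_le_treeLen_of_not_inEnl {X : Finset (Pt d)} (hc : FaceConnected X) {N r : ℕ} (hN : 0 < N)
    {x y : Pt d} (hx : x ∈ X) (hy : y ∈ X) (h : ¬ InEnl N r x y) : (r : ℝ) * N ≤ treeLen X := by
  obtain ⟨i, hi⟩ := not_inEnl_iff.1 h
  exact mul_le_treeLen_of_blockGap hc hN hx hy hi

/-- **[I] (3.5) p. 271, second case, SHARP**: *"either X∩□̃ = ∅, or X∩□̃ ≠ ∅. … In the second case X is a big domain in
ξ-scale, for example d_j(X) ≥ (Lʲη)⁻¹"* — for a cube `□` made of the π-blocks with indices in the box `[b, b + s]` (all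
coordinates; [I] p. 270: `□` a union of `2^d` neighbouring cubes of π_k, `s = 1`; `s = 0` for a single block), read in
π_j-units with blocks of `N = (Lʲη)⁻¹` cubes: if `X ∈ 𝐃_j` has a cube `x` in `□̃` (block index in `[b − 1, b + s + 1]`) and
a cube `y` outside `□̃²` (some block-index coordinate outside `[b − 2, b + s + 2]`), then `d_j(X) ≥ N` — with NO additive
slack (the cell's `B12Cubes436.treeLen_ge_of_meets` has `M(d_j(X) + 3) > R₀`). [cite: Balaban1987RG1, (3.5) p.271] -/
theorem le_treeLen_of_meets {X : Finset (Pt d)} (hc : FaceConnected X) {N : ℕ} (hN : 0 < N) (b : Pt d) (s : ℕ)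
    {x y : Pt d} (hx : x ∈ X) (hy : y ∈ X)
    (hxt : ∀ i, b i - 1 ≤ coarse N x i ∧ coarse N x i ≤ b i + s + 1)
    (hyt : ∃ i, coarse N y i ≤ b i - 3 ∨ b i + s + 3 ≤ coarse N y i) : (N : ℝ) ≤ treeLen X := by
  obtain ⟨i, hi⟩ := hyt
  have hgap : (1 : ℤ) + 1 ≤ |coarse N y i - coarse N x i| := by
    obtain ⟨h1, h2⟩ := hxt i
    rcases hi with h | h
    · rw [abs_sub_comm]
      exact le_trans (by linarith) (le_abs_self _)
    · exact le_trans (by linarith) (le_abs_self _)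
  have h := mul_le_treeLen_of_blockGap hc hN hx hy (r := 1) (by exact_mod_cast hgap)
  simpa using h

/-! ## §4. The hypothesis `hclass` of `B14.Eq348SecondClass` DISCHARGED on the concrete window system -/

/-- **The second class above the cube `c`** on the concrete system of localization domains of the window `B`
(`TreeLengthCubeSystem.cubeSys B`): the domains with a cube outside `□^{∼2}(c)` — *"X∩(□^{∼2})ᶜ ≠ ∅"*, `□` the π_n-block
of `c` (blocks of `N = Lⁿ⁻ʲ` cubes of π_j). [cite: Balaban1988Convergent, p.279 (the two cases (I.3.5))] -/
def SecondClass (B : Finset (Pt d)) (N : ℕ) (c : Cell B) (X : (sys B).Dom) : Prop := ∃ y ∈ X.1, ¬ InEnl N 2 c.1 y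

/-- Membership in the second class is decidable (a finite search). [folklore] -/
instance instDecidablePredSecondClass (B : Finset (Pt d)) (N : ℕ) (c : Cell B) :
    DecidablePred (SecondClass B N c) := fun X => by
  unfold SecondClass
  infer_instance

/-- Its complement above `c` is the first class *"X ⊂ □^{∼2}"*: every cube of `X` lies in `□^{∼2}(c)`.
[cite: Balaban1988Convergent, p.279 (the two cases (I.3.5))] -/
theorem not_secondClass_iff {B : Finset (Pt d)} {N : ℕ} {c : Cell B} {X : (sys B).Dom} :
    ¬ SecondClass B N c X ↔ ∀ y ∈ X.1, InEnl N 2 c.1 y := by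
  simp [SecondClass]

/-- **`hclass` PROVED**: on `cubeSys B`, every second-class domain above the cube `c` has `d_j(X) ≥ 2N` — literally the
hypothesis `hclass` of `B14.Eq348SecondClass.secondClass_sum_le` with `D = N` (model note M1 there, discharged).
[cite: Balaban1988Convergent, (3.48) p.280] -/
theorem hclass_cubeSys (B : Finset (Pt d)) {N : ℕ} (hN : 0 < N) (c : Cell B) :
    ∀ X ∈ (cubeSys B).above c, SecondClass B N c X → 2 * (N : ℝ) ≤ (sys B).dj X := by
  intro X hX hsec
  obtain ⟨y, hy, hny⟩ := hsec
  have hcX : c.1 ∈ X.1 := by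
    have h := (CubeSystem.mem_above (cubeSys B)).1 hX
    change c ∈ cellsOf B X.1 at h
    exact mem_cellsOf.1 h
  rw [sys_dj]
  exact two_mul_le_treeLen_of_not_inEnl X.2.2.2 hN hcX hy hny

/-- The same in the `s⁻¹`-form of `B14.Eq348SecondClass.secondClass_sum_le_pow_five` (`s = LʲL⁻ⁿ = N⁻¹`).
[cite: Balaban1988Convergent, (3.48) p.280] -/
theorem hclass_cubeSys_inv (B : Finset (Pt d)) {N : ℕ} (hN : 0 < N) (c : Cell B) :
    ∀ X ∈ (cubeSys B).above c, SecondClass B N c X → 2 * ((N : ℝ)⁻¹)⁻¹ ≤ (sys B).dj X := by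
  rw [inv_inv]
  exact hclass_cubeSys B hN c

/-- **p. 280, *"the sum over X is bounded by O(1)exp(−κ(LʲL⁻ⁿ)⁻¹)"* WITH ONLY (I.1.18) AS HYPOTHESIS**: on the concrete
system of localization domains of a window `B ⊂ ℤ^d` (d_j = `treeLen`), for every cube `c` (the cube of `z`), every
block size `N ≥ 1` (`N = Lⁿ⁻ʲ`) and reals `𝐄^{(j)}(X, z)` obeying (I.1.18) `|𝐄^{(j)}(X, z)| ≤ E₀e^{−κd_j(X)}` with
`κ/2 ≥ κ₀(4·2^d, 2d)`: `Σ_{X ∋ c, X ⊄ □^{∼2}} |𝐄^{(j)}(X, z)| ≤ E₀·K₀(4·2^d, 2d)·e^{−κN}` — `B14.Eq348SecondClass.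
secondClass_sum_le` with `degreeLE B`, `volumeLeaf B`, `hclass_cubeSys`. [cite: Balaban1988Convergent, (3.48) p.280] -/
theorem secondClass_sum_le (B : Finset (Pt d)) {N : ℕ} (hN : 0 < N) (c : Cell B) {E : (sys B).Dom → ℝ} {E₀ κ : ℝ}
    (hE₀ : 0 ≤ E₀) (hκ : kappa₀ (4 * 2 ^ d) (2 * d) ≤ κ / 2) (hκ0 : 0 ≤ κ)
    (h118 : ∀ X, |E X| ≤ E₀ * Real.exp (-κ * (sys B).dj X)) :
    ∑ X ∈ ((cubeSys B).above c).filter (SecondClass B N c), |E X|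
      ≤ E₀ * K₀ (4 * 2 ^ d) (2 * d) * Real.exp (-(κ * N)) :=
  Eq348SecondClass.secondClass_sum_le (cubeSys B) (degreeLE B) (volumeLeaf B) hE₀ hκ hκ0 h118 c
    (SecondClass B N c) (hclass_cubeSys B hN c)

/-- **p. 280, *"≦ O(1)(LʲL⁻ⁿ)⁵"* WITH ONLY (I.1.18) AS HYPOTHESIS**: the same sum is `≤ E₀K₀(4·2^d, 2d)(5/κ)⁵e⁻⁵·(N⁻¹)⁵`
(`κ > 0`; `N⁻¹ = LʲL⁻ⁿ`). [cite: Balaban1988Convergent, (3.48) p.280] -/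
theorem secondClass_sum_le_pow_five (B : Finset (Pt d)) {N : ℕ} (hN : 0 < N) (c : Cell B) {E : (sys B).Dom → ℝ}
    {E₀ κ : ℝ} (hE₀ : 0 ≤ E₀) (hκ : kappa₀ (4 * 2 ^ d) (2 * d) ≤ κ / 2) (hκ0 : 0 < κ)
    (h118 : ∀ X, |E X| ≤ E₀ * Real.exp (-κ * (sys B).dj X)) :
    ∑ X ∈ ((cubeSys B).above c).filter (SecondClass B N c), |E X|
      ≤ E₀ * K₀ (4 * 2 ^ d) (2 * d) * (((5 : ℝ) / κ) ^ 5 * Real.exp (-(5 : ℝ))) * ((N : ℝ)⁻¹) ^ 5 :=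
  Eq348SecondClass.secondClass_sum_le_pow_five (cubeSys B) (degreeLE B) (volumeLeaf B) hE₀ hκ hκ0
    (inv_pos.2 (by exact_mod_cast hN)) h118 c (SecondClass B N c) (hclass_cubeSys_inv B hN c)

/-- **"an admissible error contributing only to the constant on the right-hand side of (2.43)"** (p. 280), signed form,
(I.1.18) the only hypothesis: `|Σ_{X ∋ c, X ⊄ □^{∼2}} 𝐄^{(j)}(X, z)| ≤ E₀K₀(4·2^d, 2d)(5/κ)⁵e⁻⁵·(N⁻¹)^{5−b}` for every
`b ≥ 0` — a per-point term of the shape consumed by `B14Sect3.Rep367`. [cite: Balaban1988Convergent, (3.48) p.280] -/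
theorem abs_secondClass_sum_le (B : Finset (Pt d)) {N : ℕ} (hN : 0 < N) (c : Cell B) {E : (sys B).Dom → ℝ}
    {E₀ κ b : ℝ} (hE₀ : 0 ≤ E₀) (hκ : kappa₀ (4 * 2 ^ d) (2 * d) ≤ κ / 2) (hκ0 : 0 < κ) (hb : 0 ≤ b)
    (h118 : ∀ X, |E X| ≤ E₀ * Real.exp (-κ * (sys B).dj X)) :
    |∑ X ∈ ((cubeSys B).above c).filter (SecondClass B N c), E X|
      ≤ E₀ * K₀ (4 * 2 ^ d) (2 * d) * (((5 : ℝ) / κ) ^ 5 * Real.exp (-(5 : ℝ))) * ((N : ℝ)⁻¹) ^ ((5 : ℝ) - b) := by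
  have hN1 : (1 : ℝ) ≤ N := by exact_mod_cast hN
  exact Eq348SecondClass.abs_secondClass_sum_le (cubeSys B) (degreeLE B) (volumeLeaf B) hE₀ hκ hκ0
    (inv_pos.2 (by linarith)) (inv_le_one_of_one_le₀ hN1) hb h118 c (SecondClass B N c) (hclass_cubeSys_inv B hN c)

/-- `LʲL⁻ⁿ` as printed: for `j ≤ n` and `L > 0`, the real power `L^{(j−n)}` of `B14Sect3.Rep367` is `(Lⁿ⁻ʲ)⁻¹ = N⁻¹`.
[folklore] -/
private theorem rpow_sub_eq_inv_pow {L : ℝ} (hL : 0 < L) {j n : ℕ} (hjn : j ≤ n) :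
    L ^ ((j : ℝ) - n) = ((L ^ (n - j) : ℝ))⁻¹ := by
  rw [Real.rpow_sub hL, Real.rpow_natCast, Real.rpow_natCast]
  rw [← pow_sub_mul_pow L hjn]
  field_simp

/-- **The printed scales**: with `N = Lⁿ⁻ʲ` (`1 ≤ j ≤ n`, `L ≥ 1` an integer) the signed second-class sum above the cube
of `z` is `≤ E₀K₀(4·2^d, 2d)(5/κ)⁵e⁻⁵·(L^{j−n})^{5−b}` — the per-point shape `c·(L^{(j−n)})^{5−b}` of `B14Sect3.Rep367`/
`B14.Eq367Assembly`, (I.1.18) the only hypothesis. [cite: Balaban1988Convergent, (3.48) p.280] -/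
theorem secondClass_sum_le_scales (B : Finset (Pt d)) {L : ℕ} (hL : 0 < L) {j n : ℕ} (hjn : j ≤ n)
    (c : Cell B) {E : (sys B).Dom → ℝ} {E₀ κ b : ℝ} (hE₀ : 0 ≤ E₀) (hκ : kappa₀ (4 * 2 ^ d) (2 * d) ≤ κ / 2)
    (hκ0 : 0 < κ) (hb : 0 ≤ b) (h118 : ∀ X, |E X| ≤ E₀ * Real.exp (-κ * (sys B).dj X)) :
    |∑ X ∈ ((cubeSys B).above c).filter (SecondClass B (L ^ (n - j)) c), E X|
      ≤ E₀ * K₀ (4 * 2 ^ d) (2 * d) * (((5 : ℝ) / κ) ^ 5 * Real.exp (-(5 : ℝ)))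
        * ((L : ℝ) ^ ((j : ℝ) - n)) ^ ((5 : ℝ) - b) := by
  have hN : 0 < L ^ (n - j) := pow_pos hL _
  have h := abs_secondClass_sum_le B hN c hE₀ hκ hκ0 hb h118
  have hL' : (0 : ℝ) < L := by exact_mod_cast hL
  rw [rpow_sub_eq_inv_pow hL' hjn]
  push_cast at h ⊢
  exact h

end

end Literature.MathematicalPhysics.QuantumFieldTheory.Balaban1983to89.B14.Eq348ClassGeometry
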